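import Summits.QuantumFields.YangMills.Theorems.VirialFluxGapCentralFieldDivergence
import HarnessLib

/-!
# Route `VirialFluxGap` ∕ `SwapVirialDeficit` (YangMills): the SHARP central divergence (P3) on the window —
# `Σ_va ∂_va C_va ≤ 18L⁴ − 3 + 12(ρ + 16L²√t_C)²` for the explicit central field (upgrade (U1) of the (P) road to ⟨24196⟩)

LEAD ym-line-sfw-p2 g97 (cell ym-idea-1, free hands; `--supports stmt-QuantumFields-24196`).  w2 g53's landed (P3)
✓`central_divergence_window` reads w2 g52's bookkeeping ✓`FixFrame.centralDiv_le_budget` through its LAZY second conjunct (`≤ 18L⁴ − ½` once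
`ρ′² ≤ 5/24`); the FIRST conjunct of the same theorem is the sharp budget `18L⁴ − 3 + 12ρ′²` with `ρ′ = ρ + 16L²√F₀(P)`.  This file states (P3)
in package shape with that sharp constant:

★★ `central_divergence_window_sharp` — for signs `σ_k, σ₄ = ±1`, a radius `0 ≤ ρ ≤ 1/5`, a window `t_C ≤ (4096·L⁴)⁻¹`, at every point `x` of `X_fix`
whose three wrap masses and seam-root mass are `≤ ρ²` and with `F_fix x ≤ t_C`:
`Σ_va ∂_{fixFrameStd va}(centralCoeff L σ σ₄ va)(M_x) ≤ 18·L⁴ − 3 + 12·(ρ + 16L²√t_C)²` — so with `ρ, t_C` polynomially small the central field has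
divergence `18L⁴ − 3 + o(1)`, matching the six-kernel-vector generic count ✓`fix_generic_divergence_upper_six`; the two feed the `δ`-rerun of the
⟨24141⟩ assembly toward ✓`gibbsMeanWindow_of_eulerFieldFixFamily` ⟹ ⟨24196⟩.

HONEST LABEL: a one-step corollary of landed lemmas; the `δ`-rerun of the assembly is NOT here; ⟨24196⟩ ∕ ⟨24194⟩ ∕ ⟨24197⟩ OPEN; own crux ⟨22884⟩
OPEN (blocked-on ⟨19935⟩); the Yang–Mills mass gap is NOT proved; no summit is proved by a line.  THEOREMS ONLY (0 `def`, 0 `sorry`), standard axioms.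
References: [cite: CosteEtAl1985]; [cite: Luscher1983, §2]; [folklore].
-/

set_option autoImplicit false

noncomputable section

open scoped Matrix BigOperators ContDiff Topology Quaternion
open Literature.MathematicalPhysics.QuantumFieldTheory hiding SU2
open Literature.MathematicalPhysics.QuantumLattice

namespace Summit.QuantumFields.YangMills.Theorems.VirialFluxGap.CentralField

open Summit.QuantumFields.YangMills.Theorems.FemtoTransferGap
open Summit.QuantumFields.YangMills.Theorems.FemtoTransferGap.TT
open Summit.QuantumFields.YangMills.Theorems.FemtoTransferGap.TwoLattice
open Summit.QuantumFields.YangMills.Theorems.FemtoTransferGap.TwoLattice.Flat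
open Summit.QuantumFields.YangMills.Theorems.VirialFluxGap.RingDeficit
open Summit.QuantumFields.YangMills.Theorems.VirialFluxGap.FrameDerivative
open Summit.QuantumFields.YangMills.Theorems.VirialFluxGap.FrameHessian
open Summit.QuantumFields.YangMills.Theorems.VirialFluxGap.FixFrame
open Summit.QuantumFields.YangMills.Theorems.VirialFluxGap.CentralCoercivity

variable {L : ℕ} [NeZero L]

open scoped Matrix.Norms.Frobenius

/-- ★★ **The SHARP central divergence at a ring history in comb gauge**: with the three wrap masses and the seam-root mass `≤ ρ²` (`ρ ≥ 0`) and
`(ρ + 16L²√F₀(P))² ≤ 5/24`:  `Σ_va ∂_{fixFrameStd va}(centralCoeff L σ σ₄ va)(ringCoord P) ≤ 18L⁴ − 3 + 12(ρ + 16L²√F₀(P))²`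
(per-slot bounds of ✓`centralDiv_wrap_le_of_window` ∕ `centralDiv_seam_le_of_window` ∕ `centralDiv_plain_le'` into the FIRST conjunct of
✓`centralDiv_le_budget`). [cite: CosteEtAl1985] -/
theorem centralDiv_le_of_window_sharp {σ : Fin 3 → ℝ} (hσ : ∀ k, σ k = 1 ∨ σ k = -1) {σ₄ : ℝ} (hσ₄ : σ₄ = 1 ∨ σ₄ = -1)
    (P : (Fin (2 * L - 1 + 1) → GaugeConfig 3 L SU2) × (Site 3 L → SU2)) (ht : treeGauge (P.1 0) = 1) {ρ : ℝ} (hρ : 0 ≤ ρ)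
    (hk : ∀ k : Fin 3, 1 - (su2Quat (wrapReps (P.1 0) k)).re ^ 2 ≤ ρ ^ 2) (hs : 1 - (su2Quat (P.2 0)).re ^ 2 ≤ ρ ^ 2)
    (hρ'2 : (ρ + 16 * (L : ℝ) ^ 2 * Real.sqrt (ringDeficit L (fun _ => false) P)) ^ 2 ≤ 5 / 24) :
    ∑ va : FixVar L × Fin 3, frameD (fixFrameStd va) (centralCoeff L σ σ₄ va) (ringCoord L P) ≤
      18 * (L : ℝ) ^ 4 - 3 + 12 * (ρ + 16 * (L : ℝ) ^ 2 * Real.sqrt (ringDeficit L (fun _ => false) P)) ^ 2 :=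
  (centralDiv_le_budget σ σ₄ (ringCoord L P) (ρ + 16 * (L : ℝ) ^ 2 * Real.sqrt (ringDeficit L (fun _ => false) P))
    (fun i _ k hx => centralDiv_wrap_le_of_window hσ σ₄ P ht hρ (hk k) le_rfl hρ'2 i hx)
    (fun i e htree hx => centralDiv_plain_le' σ σ₄ P i e htree hx)
    (fun x => centralDiv_seam_le_of_window σ hσ₄ P ht hρ hs le_rfl hρ'2 x)).1

/-- ★★ **(P3) FOR THE EXPLICIT CENTRAL FIELD, SHARP, PACKAGE SHAPE.**  For signs `σ_k, σ₄ = ±1`, a radius `0 ≤ ρ ≤ 1/5` and a window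
`t_C ≤ (4096·L⁴)⁻¹`: at every point `x` of `X_fix` whose three wrap masses and seam-root mass are `≤ ρ²` and with `F_fix x ≤ t_C`,
`Σ_va ∂_{fixFrameStd va}(centralCoeff L σ σ₄ va)(M_x) ≤ 18·L⁴ − 3 + 12·(ρ + 16L²√t_C)²` — the central field has divergence `18L⁴ − 3 + o(1)` for
`ρ, t_C` polynomially small (the sharp twin of ✓`central_divergence_window`, whose constant is `18L⁴ − ½`). [cite: CosteEtAl1985] [cite: Luscher1983, §2] -/
theorem central_divergence_window_sharp {σ : Fin 3 → ℝ} (hσ : ∀ k, σ k = 1 ∨ σ k = -1) {σ₄ : ℝ} (hσ₄ : σ₄ = 1 ∨ σ₄ = -1)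
    (x : (OffIdx L → SU2) × ((Fin (2 * L - 1) → GaugeConfig 3 L SU2) × (Site 3 L → SU2))) {ρ t_C : ℝ} (hρ0 : 0 ≤ ρ) (hρ5 : ρ ≤ 1 / 5)
    (htC : t_C ≤ (4096 * (L : ℝ) ^ 4)⁻¹)
    (hk : ∀ k : Fin 3, 1 - (su2Quat (wrapReps ((Fin.cons (glue x.1) x.2.1 : Fin (2 * L - 1 + 1) → GaugeConfig 3 L SU2) 0) k)).re ^ 2 ≤ ρ ^ 2)
    (hs : 1 - (su2Quat (x.2.2 0)).re ^ 2 ≤ ρ ^ 2)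
    (hF : ringDeficit L (fun _ => false) ((Fin.cons (glue x.1) x.2.1 : Fin (2 * L - 1 + 1) → GaugeConfig 3 L SU2), x.2.2) ≤ t_C) :
    ∑ va, frameD (fixFrameStd va) (centralCoeff L σ σ₄ va) (ringCoord L ((Fin.cons (glue x.1) x.2.1 : Fin (2 * L - 1 + 1) → GaugeConfig 3 L SU2), x.2.2)) ≤
      18 * (L : ℝ) ^ 4 - 3 + 12 * (ρ + 16 * (L : ℝ) ^ 2 * Real.sqrt t_C) ^ 2 := by
  set P : (Fin (2 * L - 1 + 1) → GaugeConfig 3 L SU2) × (Site 3 L → SU2) :=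
    ((Fin.cons (glue x.1) x.2.1 : Fin (2 * L - 1 + 1) → GaugeConfig 3 L SU2), x.2.2) with hPdef
  have hP0 : P.1 0 = glue x.1 := by simp [hPdef]
  have ht : treeGauge (P.1 0) = 1 := by rw [hP0]; funext y; exact treeGauge_glue x.1 y
  have hL1 : (1 : ℝ) ≤ L := by exact_mod_cast NeZero.one_le
  have hd : 16 * (L : ℝ) ^ 2 * Real.sqrt (ringDeficit L (fun _ => false) P) ≤ 1 / 4 := sixteen_sq_sqrt_le hL1 (hF.trans htC)
  obtain ⟨hρ', h920⟩ := rho_prime_sq_le hρ5 hd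
  have hρ'0 : 0 ≤ ρ + 16 * (L : ℝ) ^ 2 * Real.sqrt (ringDeficit L (fun _ => false) P) := by positivity
  have hρ'2 : (ρ + 16 * (L : ℝ) ^ 2 * Real.sqrt (ringDeficit L (fun _ => false) P)) ^ 2 ≤ 5 / 24 :=
    (pow_le_pow_left₀ hρ'0 hρ' 2).trans h920
  have hs' : 1 - (su2Quat (P.2 0)).re ^ 2 ≤ ρ ^ 2 := hs
  have h := centralDiv_le_of_window_sharp hσ hσ₄ P ht hρ0 hk hs' hρ'2
  have hmono : ρ + 16 * (L : ℝ) ^ 2 * Real.sqrt (ringDeficit L (fun _ => false) P) ≤ ρ + 16 * (L : ℝ) ^ 2 * Real.sqrt t_C := by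
    have := Real.sqrt_le_sqrt hF
    nlinarith [sq_nonneg (L : ℝ)]
  have hsq : (ρ + 16 * (L : ℝ) ^ 2 * Real.sqrt (ringDeficit L (fun _ => false) P)) ^ 2 ≤ (ρ + 16 * (L : ℝ) ^ 2 * Real.sqrt t_C) ^ 2 :=
    pow_le_pow_left₀ hρ'0 hmono 2
  linarith

end Summit.QuantumFields.YangMills.Theorems.VirialFluxGap.CentralField

end
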